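import Summits.AtomisticToContinuum.FouriersLaw.Theses.EmbeddedDrudeMourre
import Summits.AtomisticToContinuum.FouriersLaw.Theorems.EmbeddedDrudeMourreGreenKuboContinuationThermalFamily
import Summits.AtomisticToContinuum.FouriersLaw.Theorems.EmbeddedDrudeMourreGreenKuboContinuationCanonicalSeedOfRegularState
import Summits.AtomisticToContinuum.FouriersLaw.Theorems.EmbeddedDrudeMourreGreenKuboContinuationRealVitaliTwo
import Literature.MathematicalPhysics.KineticTheory.InfiniteChainTightRegular
import Literature.MathematicalPhysics.KineticTheory.InfiniteChainShiftInvariantUniqueness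

/-!
# `GreenKuboContinuation` from the log-Gevrey tower — what the line proves, importably
(crux `EmbeddedDrudeMourre.GreenKuboContinuation`, item stmt-AtomisticToContinuum-12597, line
`temperature-blind-vitali-hurwitz`, skeleton rev 9–10; `--supports` file of the continuation lead c2)

The skeleton `Cruxes/GreenKuboContinuation/Lines/temperature_blind_vitali_hurwitz.lean` (rev 9) derives the crux
from TWO open registered stubs and eight closed ones. This file states the same implications as CLOSED theorems
with the open stubs as explicit hypotheses, so that planners and sibling routes can import them:

* `continuation_of_regularSeeds` — THE ENGINE OF THE LINE (sorry-free given the tower): if the log-Gevrey tower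
  (statement of `stub_logGevreyTower`, hypothesis `hG`) holds, then for `P = pinnedChain ω₂ lam β γ` (all `> 0`)
  and `T₀ > 0`, Abelian Green–Kubo witnesses with REGULAR STATE (DLR + shift-invariant + BM-superstable; dynamics
  arbitrary) at every `T ∈ (0, T₀)` give, at EVERY `T > 0`, the CANONICAL witness: the shift-invariant superstable
  DLR state `μ T` of the regular thermal family, the Buttà–Marchioro flow (carrier `bmGood`), `κ = T⁻² e^{L(T)} > 0`.
  Proof = the skeleton's `continuation_of_modulus` with the landed stubs plugged in (`thermalFamily`,
  `stub_regularDLRUnique`, `stub_canonicalSeedOfRegularState`, `stub_realVitaliTwo`).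
* `GreenKuboContinuation_of_witnessRegularisation_of_logGevreyTower` — the crux AS TYPED from the two open stubs
  (seam `stub_witnessRegularisation`, rev-8 tight form, hypothesis `hW`; tower `hG`): literally the composition
  `GreenKuboContinuation_of` of the skeleton, importable.
* `shiftInvariantContinuation_of_logGevreyTower`, `tightContinuation_of_logGevreyTower` — THE RETYPED CRUX NEEDS NO
  SEAM: if the crux's witness clause carries `IsShiftInvariant μT` (resp. uniform tightness of the one-site position
  marginals) — which every engine of the route produces anyway (the kinetic corner / Mourre engines work on `ℋ₀(μ_T)` of
  the canonical state) — then the tower ALONE gives the continuation, with the same regularity exported in the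
  conclusion (so the sibling crux `AbelThermodynamicLimit`, stmt-12596, would receive a regular witness and lose ITS seam
  too). This is the Lean evidence behind the lead's planner note "stub 3 is a typing artefact: retype the witness
  clauses of DrudeDissolution (export) / GreenKuboContinuation / AbelThermodynamicLimit (import) to shift-invariant states".

Nothing here is new mathematics; the only open content of the line is the hypothesis `hG` (the tower: `ν`-uniform
factorial bounds on the `T`-derivatives of `log A_T(ν)` for the canonical family — the boundedness half of an
analytic-in-`T` limiting-absorption principle; drefute g1/g2: correctly shaped, every `ν`-dependent weakening refuted,
`Theorems/GreenKuboContinuation/Negative/RealVitali{Uniformity,Prefactor}Tightness.lean`).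
-/

noncomputable section

namespace Summit.AtomisticToContinuum.FouriersLaw.Theorems.GreenKuboContinuation.TemperatureBlindVitaliHurwitz

open Filter Topology MeasureTheory Set
open Literature.MathematicalPhysics.KineticTheory.HeatConduction

/-! ## Two real-analysis conversions (as in the skeleton) -/

/-- From `T⁻² A(ν) → κ > 0` to `log A(ν) → log (T² κ)`. [folklore] -/
theorem tendsto_log_of_tendsto_inv_sq_mul' {A : ℝ → ℝ} {T κ : ℝ} (hT : 0 < T) (hκ : 0 < κ)
    (h : Tendsto (fun ν : ℝ => (T ^ 2)⁻¹ * A ν) (𝓝[>] 0) (𝓝 κ)) :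
    Tendsto (fun ν : ℝ => Real.log (A ν)) (𝓝[>] 0) (𝓝 (Real.log (T ^ 2 * κ))) := by
  have hT2 : T ^ 2 ≠ 0 := pow_ne_zero 2 hT.ne'
  have hA : Tendsto A (𝓝[>] 0) (𝓝 (T ^ 2 * κ)) := by
    have := h.const_mul (T ^ 2)
    refine this.congr' (Eventually.of_forall fun ν => ?_)
    simp only [← mul_assoc, mul_inv_cancel₀ hT2, one_mul]
  exact hA.log (mul_pos (pow_pos hT 2) hκ).ne'

/-- From `log A(ν) → L` (with `A > 0` for `ν > 0`) to `T⁻² A(ν) → T⁻² e^L`. [folklore] -/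
theorem tendsto_inv_sq_mul_of_tendsto_log' {A : ℝ → ℝ} {T L : ℝ}
    (hpos : ∀ ν : ℝ, 0 < ν → 0 < A ν)
    (h : Tendsto (fun ν : ℝ => Real.log (A ν)) (𝓝[>] 0) (𝓝 L)) :
    Tendsto (fun ν : ℝ => (T ^ 2)⁻¹ * A ν) (𝓝[>] 0) (𝓝 ((T ^ 2)⁻¹ * Real.exp L)) := by
  have hexp : Tendsto (fun ν : ℝ => Real.exp (Real.log (A ν))) (𝓝[>] 0) (𝓝 (Real.exp L)) :=
    (Real.continuous_exp.tendsto L).comp h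
  have hA : Tendsto A (𝓝[>] 0) (𝓝 (Real.exp L)) := by
    refine hexp.congr' ?_
    filter_upwards [self_mem_nhdsWithin] with ν hν
    exact Real.exp_log (hpos ν hν)
  exact hA.const_mul ((T ^ 2)⁻¹)

/-! ## The engine: regular seeds on the corner + the tower ⇒ the canonical witness at every temperature -/

/-- **`continuation_of_regularSeeds`** — the line's engine with the tower as its only hypothesis. `hG` is VERBATIM
the statement of the registered stub `stub_logGevreyTower` (skeleton rev 2–10). Conclusion: for
`P = pinnedChain ω₂ lam β γ` (all `> 0`) and `T₀ > 0`, if at every `T ∈ (0, T₀)` some Abelian Green–Kubo witness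
with REGULAR STATE exists (DLR at `T`, shift-invariant, BM-superstable; any preserving dynamics with absolutely
convergent correlations; `κ > 0`; `T⁻² ∫₀^∞ e^{-νt} C(t) dt → κ`), then at EVERY `T > 0` there is a witness whose state
is DLR, shift-invariant and superstable and whose dynamics has carrier `bmGood P` (the canonical pair). Proof:
regular thermal family (`thermalFamily`) → canonical seeds on the corner (`stub_regularDLRUnique` +
`stub_canonicalSeedOfRegularState` + `log`) → smoothness and `k ≥ 2` factorial bounds (`hG`) → `k ≥ 2` Vitali
(`stub_realVitaliTwo`) → exponentiate. [cite: ButtaMarchioro2016, Thm 2.1; CassandroOlivieriPellegrinottiPresutti1978, §3] -/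
theorem continuation_of_regularSeeds :
    (∀ ω₂ lam β γ : ℝ, 0 < ω₂ → 0 < lam → 0 < β → 0 < γ →
      ∀ (μ : ℝ → MeasureTheory.Measure Literature.MathematicalPhysics.KineticTheory.HeatConduction.ChainConfig) (D : Literature.MathematicalPhysics.KineticTheory.HeatConduction.InfiniteChainDynamics (Literature.MathematicalPhysics.KineticTheory.HeatConduction.pinnedChain ω₂ lam β γ)),
        (D.carrier = (Literature.MathematicalPhysics.KineticTheory.HeatConduction.pinnedChain ω₂ lam β γ).bmGood ∧
          ∀ T : ℝ, 0 < T →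
            (Literature.MathematicalPhysics.KineticTheory.HeatConduction.pinnedChain ω₂ lam β γ).IsChainGibbsMeasure T (μ T) ∧ Literature.MathematicalPhysics.KineticTheory.HeatConduction.IsShiftInvariant (μ T) ∧
            (Literature.MathematicalPhysics.KineticTheory.HeatConduction.pinnedChain ω₂ lam β γ).HasSuperstabilityEstimate (μ T) ∧ D.PreservesMeasure (μ T) ∧
            (∀ t : ℝ, D.HasAbsConvergentCorrelation (μ T) t) ∧
            (∀ ν : ℝ, 0 < ν →
              0 < ∫ t in Set.Ioi (0:ℝ), Real.exp (-(ν * t)) * D.currentCorrelation (μ T) t)) →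
        (∀ T : ℝ, 0 < T → ∀ μ₁ μ₂ : MeasureTheory.Measure Literature.MathematicalPhysics.KineticTheory.HeatConduction.ChainConfig,
            (Literature.MathematicalPhysics.KineticTheory.HeatConduction.pinnedChain ω₂ lam β γ).IsChainGibbsMeasure T μ₁ → Literature.MathematicalPhysics.KineticTheory.HeatConduction.IsShiftInvariant μ₁ →
            (Literature.MathematicalPhysics.KineticTheory.HeatConduction.pinnedChain ω₂ lam β γ).HasSuperstabilityEstimate μ₁ →
            (Literature.MathematicalPhysics.KineticTheory.HeatConduction.pinnedChain ω₂ lam β γ).IsChainGibbsMeasure T μ₂ → Literature.MathematicalPhysics.KineticTheory.HeatConduction.IsShiftInvariant μ₂ →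
            (Literature.MathematicalPhysics.KineticTheory.HeatConduction.pinnedChain ω₂ lam β γ).HasSuperstabilityEstimate μ₂ → μ₁ = μ₂) →
        (∀ ν : ℝ, 0 < ν → ν ≤ 1 → ∀ k : ℕ, DifferentiableOn ℝ (iteratedDeriv k (fun T : ℝ => Real.log
          (∫ t in Set.Ioi (0:ℝ), Real.exp (-(ν * t)) * D.currentCorrelation (μ T) t))) (Set.Ioi 0)) ∧
        ∀ a b : ℝ, 0 < a → a < b → ∃ C : ℝ, 0 < C ∧ ∀ ν : ℝ, 0 < ν → ν ≤ 1 →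
          ∀ k : ℕ, 2 ≤ k → ∀ T ∈ Set.Icc a b,
            |iteratedDeriv k (fun T : ℝ => Real.log
              (∫ t in Set.Ioi (0:ℝ), Real.exp (-(ν * t)) * D.currentCorrelation (μ T) t)) T| ≤
              C ^ (k + 1) * (k.factorial : ℝ)) →
    ∀ ω₂ lam β γ : ℝ, 0 < ω₂ → 0 < lam → 0 < β → 0 < γ → ∀ T₀ : ℝ, 0 < T₀ →
      (∀ T : ℝ, 0 < T → T < T₀ →
        ∃ (μT : MeasureTheory.Measure Literature.MathematicalPhysics.KineticTheory.HeatConduction.ChainConfig) (D' : Literature.MathematicalPhysics.KineticTheory.HeatConduction.InfiniteChainDynamics (Literature.MathematicalPhysics.KineticTheory.HeatConduction.pinnedChain ω₂ lam β γ)) (κ : ℝ),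
          (Literature.MathematicalPhysics.KineticTheory.HeatConduction.pinnedChain ω₂ lam β γ).IsChainGibbsMeasure T μT ∧ Literature.MathematicalPhysics.KineticTheory.HeatConduction.IsShiftInvariant μT ∧
          (Literature.MathematicalPhysics.KineticTheory.HeatConduction.pinnedChain ω₂ lam β γ).HasSuperstabilityEstimate μT ∧ D'.PreservesMeasure μT ∧
          (∀ t : ℝ, D'.HasAbsConvergentCorrelation μT t) ∧ 0 < κ ∧
          Filter.Tendsto (fun ν : ℝ => (T ^ 2)⁻¹ *
            ∫ t in Set.Ioi (0:ℝ), Real.exp (-(ν * t)) * D'.currentCorrelation μT t) (nhdsWithin (0:ℝ) (Set.Ioi 0)) (nhds κ)) →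
      ∀ T : ℝ, 0 < T →
        ∃ (μT : MeasureTheory.Measure Literature.MathematicalPhysics.KineticTheory.HeatConduction.ChainConfig) (D : Literature.MathematicalPhysics.KineticTheory.HeatConduction.InfiniteChainDynamics (Literature.MathematicalPhysics.KineticTheory.HeatConduction.pinnedChain ω₂ lam β γ)) (κ : ℝ),
          (Literature.MathematicalPhysics.KineticTheory.HeatConduction.pinnedChain ω₂ lam β γ).IsChainGibbsMeasure T μT ∧ Literature.MathematicalPhysics.KineticTheory.HeatConduction.IsShiftInvariant μT ∧
          (Literature.MathematicalPhysics.KineticTheory.HeatConduction.pinnedChain ω₂ lam β γ).HasSuperstabilityEstimate μT ∧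
          D.carrier = (Literature.MathematicalPhysics.KineticTheory.HeatConduction.pinnedChain ω₂ lam β γ).bmGood ∧ D.PreservesMeasure μT ∧
          (∀ t : ℝ, D.HasAbsConvergentCorrelation μT t) ∧ 0 < κ ∧
          Filter.Tendsto (fun ν : ℝ => (T ^ 2)⁻¹ *
            ∫ t in Set.Ioi (0:ℝ), Real.exp (-(ν * t)) * D.currentCorrelation μT t) (nhdsWithin (0:ℝ) (Set.Ioi 0)) (nhds κ) := by
  intro hG ω₂ lam β γ hω hl hβ hγ T₀ hT₀ hcorner T hT
  -- the regular thermal family (one flow, moving Gibbs measure)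
  obtain ⟨μ, D, hcar, hRT⟩ := thermalFamily ω₂ lam β γ hω hl hβ hγ
  have hreg : D.carrier = (pinnedChain ω₂ lam β γ).bmGood ∧ ∀ T : ℝ, 0 < T →
      (pinnedChain ω₂ lam β γ).IsChainGibbsMeasure T (μ T) ∧ IsShiftInvariant (μ T) ∧
      (pinnedChain ω₂ lam β γ).HasSuperstabilityEstimate (μ T) ∧ D.PreservesMeasure (μ T) ∧
      (∀ t : ℝ, D.HasAbsConvergentCorrelation (μ T) t) ∧
      (∀ ν : ℝ, 0 < ν → 0 < ∫ t in Ioi (0:ℝ), Real.exp (-(ν * t)) * D.currentCorrelation (μ T) t) :=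
    ⟨hcar, hRT⟩
  have hApos : ∀ T' : ℝ, 0 < T' → ∀ ν : ℝ, 0 < ν →
      0 < ∫ t in Ioi (0:ℝ), Real.exp (-(ν * t)) * D.currentCorrelation (μ T') t :=
    fun T' hT' => (hRT T' hT').2.2.2.2.2
  -- DLR uniqueness in the regular class
  have hUq := stub_regularDLRUnique ω₂ lam β γ hω hl hβ hγ
  -- canonical seeds on the corner: the canonical log-Abel functional converges at every T' < T₀
  have hseed : ∀ T' : ℝ, 0 < T' → T' < T₀ → ∃ L : ℝ, Tendsto (fun ν : ℝ => Real.log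
      (∫ t in Ioi (0:ℝ), Real.exp (-(ν * t)) * D.currentCorrelation (μ T') t)) (𝓝[>] 0) (𝓝 L) := by
    intro T' hT' hlt
    obtain ⟨κ', hκ', hlim⟩ := stub_canonicalSeedOfRegularState ω₂ lam β γ hω hl hβ hγ μ D hreg T' hT'
      (hUq T' hT') (hcorner T' hT' hlt)
    exact ⟨_, tendsto_log_of_tendsto_inv_sq_mul' hT' hκ' hlim⟩
  -- the tower: smoothness and the ∀ k ≥ 2 factorial bounds, ν-uniform on compacts
  obtain ⟨hsmooth, hGk⟩ := hG ω₂ lam β γ hω hl hβ hγ μ D hreg hUq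
  -- k ≥ 2 Vitali-type propagation to every temperature
  obtain ⟨L, hL⟩ := stub_realVitaliTwo (fun ν T'' => Real.log
      (∫ t in Ioi (0:ℝ), Real.exp (-(ν * t)) * D.currentCorrelation (μ T'') t))
    T₀ hT₀ hsmooth hGk hseed T hT
  -- exponentiate and read off the canonical witness
  refine ⟨μ T, D, (T ^ 2)⁻¹ * Real.exp L, (hRT T hT).1, (hRT T hT).2.1, (hRT T hT).2.2.1, hcar,
    (hRT T hT).2.2.2.1, (hRT T hT).2.2.2.2.1, mul_pos (inv_pos.mpr (pow_pos hT 2)) (Real.exp_pos L), ?_⟩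
  exact tendsto_inv_sq_mul_of_tendsto_log' (hApos T hT) hL

/-! ## The crux as typed: seam + tower -/

/-- **The crux from its two open stubs** (= the skeleton theorem `GreenKuboContinuation_of`, rev 9, importable):
`hW` is VERBATIM the registered stub `stub_witnessRegularisation` (rev-8 tight form: a temperature witnessed by ANY
DLR pair is witnessed by a pair whose state has uniformly tight one-site position marginals) and `hG` VERBATIM the
registered stub `stub_logGevreyTower`. A tight DLR state of the pinned chain is shift-invariant and superstable
(`OscillatorChain.isShiftInvariant_and_hasSuperstabilityEstimate_of_tight_pinnedChain`), so the seeds are regular and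
`continuation_of_regularSeeds` applies. [cite: ButtaMarchioro2016, Thm 2.1; CassandroOlivieriPellegrinottiPresutti1978, §3] -/
theorem GreenKuboContinuation_of_witnessRegularisation_of_logGevreyTower :
    (∀ ω₂ lam β γ : ℝ, 0 < ω₂ → 0 < lam → 0 < β → 0 < γ → ∀ T : ℝ, 0 < T →
      (∃ (μT : MeasureTheory.Measure Literature.MathematicalPhysics.KineticTheory.HeatConduction.ChainConfig) (D' : Literature.MathematicalPhysics.KineticTheory.HeatConduction.InfiniteChainDynamics (Literature.MathematicalPhysics.KineticTheory.HeatConduction.pinnedChain ω₂ lam β γ)) (κ : ℝ),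
            (Literature.MathematicalPhysics.KineticTheory.HeatConduction.pinnedChain ω₂ lam β γ).IsChainGibbsMeasure T μT ∧ D'.PreservesMeasure μT ∧
            (∀ t : ℝ, D'.HasAbsConvergentCorrelation μT t) ∧ 0 < κ ∧
            Filter.Tendsto (fun ν : ℝ => (T ^ 2)⁻¹ *
              ∫ t in Set.Ioi (0:ℝ), Real.exp (-(ν * t)) * D'.currentCorrelation μT t) (nhdsWithin (0:ℝ) (Set.Ioi 0)) (nhds κ)) →
      (∃ (μT : MeasureTheory.Measure Literature.MathematicalPhysics.KineticTheory.HeatConduction.ChainConfig) (D' : Literature.MathematicalPhysics.KineticTheory.HeatConduction.InfiniteChainDynamics (Literature.MathematicalPhysics.KineticTheory.HeatConduction.pinnedChain ω₂ lam β γ)) (κ : ℝ),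
            (Literature.MathematicalPhysics.KineticTheory.HeatConduction.pinnedChain ω₂ lam β γ).IsChainGibbsMeasure T μT ∧
            (∀ ε : ℝ, 0 < ε → ∃ R : ℝ, ∀ x : ℤ, μT {σ : Literature.MathematicalPhysics.KineticTheory.HeatConduction.ChainConfig | R < |(σ x).1|} ≤ ENNReal.ofReal ε) ∧
            D'.PreservesMeasure μT ∧
            (∀ t : ℝ, D'.HasAbsConvergentCorrelation μT t) ∧ 0 < κ ∧
            Filter.Tendsto (fun ν : ℝ => (T ^ 2)⁻¹ *
              ∫ t in Set.Ioi (0:ℝ), Real.exp (-(ν * t)) * D'.currentCorrelation μT t) (nhdsWithin (0:ℝ) (Set.Ioi 0)) (nhds κ))) →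
    (∀ ω₂ lam β γ : ℝ, 0 < ω₂ → 0 < lam → 0 < β → 0 < γ →
      ∀ (μ : ℝ → MeasureTheory.Measure Literature.MathematicalPhysics.KineticTheory.HeatConduction.ChainConfig) (D : Literature.MathematicalPhysics.KineticTheory.HeatConduction.InfiniteChainDynamics (Literature.MathematicalPhysics.KineticTheory.HeatConduction.pinnedChain ω₂ lam β γ)),
        (D.carrier = (Literature.MathematicalPhysics.KineticTheory.HeatConduction.pinnedChain ω₂ lam β γ).bmGood ∧
          ∀ T : ℝ, 0 < T →
            (Literature.MathematicalPhysics.KineticTheory.HeatConduction.pinnedChain ω₂ lam β γ).IsChainGibbsMeasure T (μ T) ∧ Literature.MathematicalPhysics.KineticTheory.HeatConduction.IsShiftInvariant (μ T) ∧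
            (Literature.MathematicalPhysics.KineticTheory.HeatConduction.pinnedChain ω₂ lam β γ).HasSuperstabilityEstimate (μ T) ∧ D.PreservesMeasure (μ T) ∧
            (∀ t : ℝ, D.HasAbsConvergentCorrelation (μ T) t) ∧
            (∀ ν : ℝ, 0 < ν →
              0 < ∫ t in Set.Ioi (0:ℝ), Real.exp (-(ν * t)) * D.currentCorrelation (μ T) t)) →
        (∀ T : ℝ, 0 < T → ∀ μ₁ μ₂ : MeasureTheory.Measure Literature.MathematicalPhysics.KineticTheory.HeatConduction.ChainConfig,
            (Literature.MathematicalPhysics.KineticTheory.HeatConduction.pinnedChain ω₂ lam β γ).IsChainGibbsMeasure T μ₁ → Literature.MathematicalPhysics.KineticTheory.HeatConduction.IsShiftInvariant μ₁ →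
            (Literature.MathematicalPhysics.KineticTheory.HeatConduction.pinnedChain ω₂ lam β γ).HasSuperstabilityEstimate μ₁ →
            (Literature.MathematicalPhysics.KineticTheory.HeatConduction.pinnedChain ω₂ lam β γ).IsChainGibbsMeasure T μ₂ → Literature.MathematicalPhysics.KineticTheory.HeatConduction.IsShiftInvariant μ₂ →
            (Literature.MathematicalPhysics.KineticTheory.HeatConduction.pinnedChain ω₂ lam β γ).HasSuperstabilityEstimate μ₂ → μ₁ = μ₂) →
        (∀ ν : ℝ, 0 < ν → ν ≤ 1 → ∀ k : ℕ, DifferentiableOn ℝ (iteratedDeriv k (fun T : ℝ => Real.log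
          (∫ t in Set.Ioi (0:ℝ), Real.exp (-(ν * t)) * D.currentCorrelation (μ T) t))) (Set.Ioi 0)) ∧
        ∀ a b : ℝ, 0 < a → a < b → ∃ C : ℝ, 0 < C ∧ ∀ ν : ℝ, 0 < ν → ν ≤ 1 →
          ∀ k : ℕ, 2 ≤ k → ∀ T ∈ Set.Icc a b,
            |iteratedDeriv k (fun T : ℝ => Real.log
              (∫ t in Set.Ioi (0:ℝ), Real.exp (-(ν * t)) * D.currentCorrelation (μ T) t)) T| ≤
              C ^ (k + 1) * (k.factorial : ℝ)) →
    Summit.AtomisticToContinuum.FouriersLaw.Theses.EmbeddedDrudeMourre.GreenKuboContinuation := by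
  intro hW hG ω₂ lam β γ hω hl hβ hγ T₀ hT₀ hcorner T hT
  have hreg : ∀ T : ℝ, 0 < T → T < T₀ →
      ∃ (μT : Measure ChainConfig) (D' : InfiniteChainDynamics (pinnedChain ω₂ lam β γ)) (κ : ℝ),
        (pinnedChain ω₂ lam β γ).IsChainGibbsMeasure T μT ∧ IsShiftInvariant μT ∧
        (pinnedChain ω₂ lam β γ).HasSuperstabilityEstimate μT ∧ D'.PreservesMeasure μT ∧
        (∀ t : ℝ, D'.HasAbsConvergentCorrelation μT t) ∧ 0 < κ ∧
        Tendsto (fun ν : ℝ => (T ^ 2)⁻¹ *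
          ∫ t in Ioi (0:ℝ), Real.exp (-(ν * t)) * D'.currentCorrelation μT t) (𝓝[>] 0) (𝓝 κ) := by
    intro T' hT' hlt
    obtain ⟨μT, D', κ, hGi, ht, hP, hAC, hκ, hlim⟩ :=
      hW ω₂ lam β γ hω hl hβ hγ T' hT' (hcorner T' hT' hlt)
    obtain ⟨hS, hSS⟩ :=
      OscillatorChain.isShiftInvariant_and_hasSuperstabilityEstimate_of_tight_pinnedChain γ hω hl.le hβ.le hT' hGi ht
    exact ⟨μT, D', κ, hGi, hS, hSS, hP, hAC, hκ, hlim⟩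
  obtain ⟨μT, D, κ, hGi, _hS, _hSS, _hcar, hP, hAC, hκ, hlim⟩ :=
    continuation_of_regularSeeds hG ω₂ lam β γ hω hl hβ hγ T₀ hT₀ hreg T hT
  exact ⟨μT, D, κ, hGi, hP, hAC, hκ, hlim⟩

/-! ## The retyped crux needs no seam -/

/-- **Retyped crux, shift-invariant witness states — from the tower ALONE.** If the witness clause of
`GreenKuboContinuation` carries `IsShiftInvariant μT` (in the hypothesis; it then comes for free in the conclusion),
the identification seam disappears: a shift-invariant DLR state of the pinned chain is superstable
(`OscillatorChain.hasSuperstabilityEstimate_of_isShiftInvariant_pinnedChain`) and `continuation_of_regularSeeds`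
applies. `hG` is VERBATIM the registered stub `stub_logGevreyTower`. [cite: ButtaMarchioro2016, Thm 2.1; CassandroOlivieriPellegrinottiPresutti1978, §3] -/
theorem shiftInvariantContinuation_of_logGevreyTower :
    (∀ ω₂ lam β γ : ℝ, 0 < ω₂ → 0 < lam → 0 < β → 0 < γ →
      ∀ (μ : ℝ → MeasureTheory.Measure Literature.MathematicalPhysics.KineticTheory.HeatConduction.ChainConfig) (D : Literature.MathematicalPhysics.KineticTheory.HeatConduction.InfiniteChainDynamics (Literature.MathematicalPhysics.KineticTheory.HeatConduction.pinnedChain ω₂ lam β γ)),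
        (D.carrier = (Literature.MathematicalPhysics.KineticTheory.HeatConduction.pinnedChain ω₂ lam β γ).bmGood ∧
          ∀ T : ℝ, 0 < T →
            (Literature.MathematicalPhysics.KineticTheory.HeatConduction.pinnedChain ω₂ lam β γ).IsChainGibbsMeasure T (μ T) ∧ Literature.MathematicalPhysics.KineticTheory.HeatConduction.IsShiftInvariant (μ T) ∧
            (Literature.MathematicalPhysics.KineticTheory.HeatConduction.pinnedChain ω₂ lam β γ).HasSuperstabilityEstimate (μ T) ∧ D.PreservesMeasure (μ T) ∧
            (∀ t : ℝ, D.HasAbsConvergentCorrelation (μ T) t) ∧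
            (∀ ν : ℝ, 0 < ν →
              0 < ∫ t in Set.Ioi (0:ℝ), Real.exp (-(ν * t)) * D.currentCorrelation (μ T) t)) →
        (∀ T : ℝ, 0 < T → ∀ μ₁ μ₂ : MeasureTheory.Measure Literature.MathematicalPhysics.KineticTheory.HeatConduction.ChainConfig,
            (Literature.MathematicalPhysics.KineticTheory.HeatConduction.pinnedChain ω₂ lam β γ).IsChainGibbsMeasure T μ₁ → Literature.MathematicalPhysics.KineticTheory.HeatConduction.IsShiftInvariant μ₁ →
            (Literature.MathematicalPhysics.KineticTheory.HeatConduction.pinnedChain ω₂ lam β γ).HasSuperstabilityEstimate μ₁ →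
            (Literature.MathematicalPhysics.KineticTheory.HeatConduction.pinnedChain ω₂ lam β γ).IsChainGibbsMeasure T μ₂ → Literature.MathematicalPhysics.KineticTheory.HeatConduction.IsShiftInvariant μ₂ →
            (Literature.MathematicalPhysics.KineticTheory.HeatConduction.pinnedChain ω₂ lam β γ).HasSuperstabilityEstimate μ₂ → μ₁ = μ₂) →
        (∀ ν : ℝ, 0 < ν → ν ≤ 1 → ∀ k : ℕ, DifferentiableOn ℝ (iteratedDeriv k (fun T : ℝ => Real.log
          (∫ t in Set.Ioi (0:ℝ), Real.exp (-(ν * t)) * D.currentCorrelation (μ T) t))) (Set.Ioi 0)) ∧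
        ∀ a b : ℝ, 0 < a → a < b → ∃ C : ℝ, 0 < C ∧ ∀ ν : ℝ, 0 < ν → ν ≤ 1 →
          ∀ k : ℕ, 2 ≤ k → ∀ T ∈ Set.Icc a b,
            |iteratedDeriv k (fun T : ℝ => Real.log
              (∫ t in Set.Ioi (0:ℝ), Real.exp (-(ν * t)) * D.currentCorrelation (μ T) t)) T| ≤
              C ^ (k + 1) * (k.factorial : ℝ)) →
    ∀ ω₂ lam β γ : ℝ, 0 < ω₂ → 0 < lam → 0 < β → 0 < γ → ∀ T₀ : ℝ, 0 < T₀ →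
      (∀ T : ℝ, 0 < T → T < T₀ →
        ∃ (μT : MeasureTheory.Measure Literature.MathematicalPhysics.KineticTheory.HeatConduction.ChainConfig)
          (D : Literature.MathematicalPhysics.KineticTheory.HeatConduction.InfiniteChainDynamics
            (Literature.MathematicalPhysics.KineticTheory.HeatConduction.pinnedChain ω₂ lam β γ)) (κ : ℝ),
          (Literature.MathematicalPhysics.KineticTheory.HeatConduction.pinnedChain ω₂ lam β γ).IsChainGibbsMeasure T μT ∧
          Literature.MathematicalPhysics.KineticTheory.HeatConduction.IsShiftInvariant μT ∧
          D.PreservesMeasure μT ∧ (∀ t : ℝ, D.HasAbsConvergentCorrelation μT t) ∧ 0 < κ ∧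
          Filter.Tendsto (fun ν : ℝ => (T ^ 2)⁻¹ *
            MeasureTheory.integral (MeasureTheory.volume.restrict (Set.Ioi (0:ℝ)))
              (fun t : ℝ => Real.exp (-(ν * t)) * D.currentCorrelation μT t))
            (nhdsWithin (0:ℝ) (Set.Ioi 0)) (nhds κ)) →
      ∀ T : ℝ, 0 < T →
        ∃ (μT : MeasureTheory.Measure Literature.MathematicalPhysics.KineticTheory.HeatConduction.ChainConfig)
          (D : Literature.MathematicalPhysics.KineticTheory.HeatConduction.InfiniteChainDynamics
            (Literature.MathematicalPhysics.KineticTheory.HeatConduction.pinnedChain ω₂ lam β γ)) (κ : ℝ),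
          (Literature.MathematicalPhysics.KineticTheory.HeatConduction.pinnedChain ω₂ lam β γ).IsChainGibbsMeasure T μT ∧
          Literature.MathematicalPhysics.KineticTheory.HeatConduction.IsShiftInvariant μT ∧
          D.PreservesMeasure μT ∧ (∀ t : ℝ, D.HasAbsConvergentCorrelation μT t) ∧ 0 < κ ∧
          Filter.Tendsto (fun ν : ℝ => (T ^ 2)⁻¹ *
            MeasureTheory.integral (MeasureTheory.volume.restrict (Set.Ioi (0:ℝ)))
              (fun t : ℝ => Real.exp (-(ν * t)) * D.currentCorrelation μT t))
            (nhdsWithin (0:ℝ) (Set.Ioi 0)) (nhds κ) := by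
  intro hG ω₂ lam β γ hω hl hβ hγ T₀ hT₀ hcorner T hT
  have hreg : ∀ T : ℝ, 0 < T → T < T₀ →
      ∃ (μT : Measure ChainConfig) (D' : InfiniteChainDynamics (pinnedChain ω₂ lam β γ)) (κ : ℝ),
        (pinnedChain ω₂ lam β γ).IsChainGibbsMeasure T μT ∧ IsShiftInvariant μT ∧
        (pinnedChain ω₂ lam β γ).HasSuperstabilityEstimate μT ∧ D'.PreservesMeasure μT ∧
        (∀ t : ℝ, D'.HasAbsConvergentCorrelation μT t) ∧ 0 < κ ∧
        Tendsto (fun ν : ℝ => (T ^ 2)⁻¹ *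
          ∫ t in Ioi (0:ℝ), Real.exp (-(ν * t)) * D'.currentCorrelation μT t) (𝓝[>] 0) (𝓝 κ) := by
    intro T' hT' hlt
    obtain ⟨μT, D', κ, hGi, hS, hP, hAC, hκ, hlim⟩ := hcorner T' hT' hlt
    exact ⟨μT, D', κ, hGi, hS,
      OscillatorChain.hasSuperstabilityEstimate_of_isShiftInvariant_pinnedChain γ hω hl.le hβ.le hT' hGi hS,
      hP, hAC, hκ, hlim⟩
  obtain ⟨μT, D, κ, hGi, hS, _hSS, _hcar, hP, hAC, hκ, hlim⟩ :=
    continuation_of_regularSeeds hG ω₂ lam β γ hω hl hβ hγ T₀ hT₀ hreg T hT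
  exact ⟨μT, D, κ, hGi, hS, hP, hAC, hκ, hlim⟩

/-- **Retyped crux, tight witness states — from the tower ALONE.** Same as
`shiftInvariantContinuation_of_logGevreyTower` with the weaker regularity clause "uniformly tight one-site position
marginals" (`∀ ε > 0, ∃ R, ∀ x, μT {R < |q_x|} ≤ ε`) in the hypothesis (a tight DLR state of the pinned chain is
shift-invariant and superstable, `OscillatorChain.isShiftInvariant_and_hasSuperstabilityEstimate_of_tight_pinnedChain`)
and shift invariance exported in the conclusion. [cite: ButtaMarchioro2016, Thm 2.1; CassandroOlivieriPellegrinottiPresutti1978, §3] -/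
theorem tightContinuation_of_logGevreyTower :
    (∀ ω₂ lam β γ : ℝ, 0 < ω₂ → 0 < lam → 0 < β → 0 < γ →
      ∀ (μ : ℝ → MeasureTheory.Measure Literature.MathematicalPhysics.KineticTheory.HeatConduction.ChainConfig) (D : Literature.MathematicalPhysics.KineticTheory.HeatConduction.InfiniteChainDynamics (Literature.MathematicalPhysics.KineticTheory.HeatConduction.pinnedChain ω₂ lam β γ)),
        (D.carrier = (Literature.MathematicalPhysics.KineticTheory.HeatConduction.pinnedChain ω₂ lam β γ).bmGood ∧
          ∀ T : ℝ, 0 < T →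
            (Literature.MathematicalPhysics.KineticTheory.HeatConduction.pinnedChain ω₂ lam β γ).IsChainGibbsMeasure T (μ T) ∧ Literature.MathematicalPhysics.KineticTheory.HeatConduction.IsShiftInvariant (μ T) ∧
            (Literature.MathematicalPhysics.KineticTheory.HeatConduction.pinnedChain ω₂ lam β γ).HasSuperstabilityEstimate (μ T) ∧ D.PreservesMeasure (μ T) ∧
            (∀ t : ℝ, D.HasAbsConvergentCorrelation (μ T) t) ∧
            (∀ ν : ℝ, 0 < ν →
              0 < ∫ t in Set.Ioi (0:ℝ), Real.exp (-(ν * t)) * D.currentCorrelation (μ T) t)) →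
        (∀ T : ℝ, 0 < T → ∀ μ₁ μ₂ : MeasureTheory.Measure Literature.MathematicalPhysics.KineticTheory.HeatConduction.ChainConfig,
            (Literature.MathematicalPhysics.KineticTheory.HeatConduction.pinnedChain ω₂ lam β γ).IsChainGibbsMeasure T μ₁ → Literature.MathematicalPhysics.KineticTheory.HeatConduction.IsShiftInvariant μ₁ →
            (Literature.MathematicalPhysics.KineticTheory.HeatConduction.pinnedChain ω₂ lam β γ).HasSuperstabilityEstimate μ₁ →
            (Literature.MathematicalPhysics.KineticTheory.HeatConduction.pinnedChain ω₂ lam β γ).IsChainGibbsMeasure T μ₂ → Literature.MathematicalPhysics.KineticTheory.HeatConduction.IsShiftInvariant μ₂ →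
            (Literature.MathematicalPhysics.KineticTheory.HeatConduction.pinnedChain ω₂ lam β γ).HasSuperstabilityEstimate μ₂ → μ₁ = μ₂) →
        (∀ ν : ℝ, 0 < ν → ν ≤ 1 → ∀ k : ℕ, DifferentiableOn ℝ (iteratedDeriv k (fun T : ℝ => Real.log
          (∫ t in Set.Ioi (0:ℝ), Real.exp (-(ν * t)) * D.currentCorrelation (μ T) t))) (Set.Ioi 0)) ∧
        ∀ a b : ℝ, 0 < a → a < b → ∃ C : ℝ, 0 < C ∧ ∀ ν : ℝ, 0 < ν → ν ≤ 1 →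
          ∀ k : ℕ, 2 ≤ k → ∀ T ∈ Set.Icc a b,
            |iteratedDeriv k (fun T : ℝ => Real.log
              (∫ t in Set.Ioi (0:ℝ), Real.exp (-(ν * t)) * D.currentCorrelation (μ T) t)) T| ≤
              C ^ (k + 1) * (k.factorial : ℝ)) →
    ∀ ω₂ lam β γ : ℝ, 0 < ω₂ → 0 < lam → 0 < β → 0 < γ → ∀ T₀ : ℝ, 0 < T₀ →
      (∀ T : ℝ, 0 < T → T < T₀ →
        ∃ (μT : MeasureTheory.Measure Literature.MathematicalPhysics.KineticTheory.HeatConduction.ChainConfig)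
          (D : Literature.MathematicalPhysics.KineticTheory.HeatConduction.InfiniteChainDynamics
            (Literature.MathematicalPhysics.KineticTheory.HeatConduction.pinnedChain ω₂ lam β γ)) (κ : ℝ),
          (Literature.MathematicalPhysics.KineticTheory.HeatConduction.pinnedChain ω₂ lam β γ).IsChainGibbsMeasure T μT ∧
          (∀ ε : ℝ, 0 < ε → ∃ R : ℝ, ∀ x : ℤ,
            μT {σ : Literature.MathematicalPhysics.KineticTheory.HeatConduction.ChainConfig | R < |(σ x).1|} ≤
              ENNReal.ofReal ε) ∧
          D.PreservesMeasure μT ∧ (∀ t : ℝ, D.HasAbsConvergentCorrelation μT t) ∧ 0 < κ ∧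
          Filter.Tendsto (fun ν : ℝ => (T ^ 2)⁻¹ *
            MeasureTheory.integral (MeasureTheory.volume.restrict (Set.Ioi (0:ℝ)))
              (fun t : ℝ => Real.exp (-(ν * t)) * D.currentCorrelation μT t))
            (nhdsWithin (0:ℝ) (Set.Ioi 0)) (nhds κ)) →
      ∀ T : ℝ, 0 < T →
        ∃ (μT : MeasureTheory.Measure Literature.MathematicalPhysics.KineticTheory.HeatConduction.ChainConfig)
          (D : Literature.MathematicalPhysics.KineticTheory.HeatConduction.InfiniteChainDynamics
            (Literature.MathematicalPhysics.KineticTheory.HeatConduction.pinnedChain ω₂ lam β γ)) (κ : ℝ),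
          (Literature.MathematicalPhysics.KineticTheory.HeatConduction.pinnedChain ω₂ lam β γ).IsChainGibbsMeasure T μT ∧
          Literature.MathematicalPhysics.KineticTheory.HeatConduction.IsShiftInvariant μT ∧
          D.PreservesMeasure μT ∧ (∀ t : ℝ, D.HasAbsConvergentCorrelation μT t) ∧ 0 < κ ∧
          Filter.Tendsto (fun ν : ℝ => (T ^ 2)⁻¹ *
            MeasureTheory.integral (MeasureTheory.volume.restrict (Set.Ioi (0:ℝ)))
              (fun t : ℝ => Real.exp (-(ν * t)) * D.currentCorrelation μT t))
            (nhdsWithin (0:ℝ) (Set.Ioi 0)) (nhds κ) := by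
  intro hG ω₂ lam β γ hω hl hβ hγ T₀ hT₀ hcorner T hT
  have hreg : ∀ T : ℝ, 0 < T → T < T₀ →
      ∃ (μT : Measure ChainConfig) (D' : InfiniteChainDynamics (pinnedChain ω₂ lam β γ)) (κ : ℝ),
        (pinnedChain ω₂ lam β γ).IsChainGibbsMeasure T μT ∧ IsShiftInvariant μT ∧
        (pinnedChain ω₂ lam β γ).HasSuperstabilityEstimate μT ∧ D'.PreservesMeasure μT ∧
        (∀ t : ℝ, D'.HasAbsConvergentCorrelation μT t) ∧ 0 < κ ∧
        Tendsto (fun ν : ℝ => (T ^ 2)⁻¹ *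
          ∫ t in Ioi (0:ℝ), Real.exp (-(ν * t)) * D'.currentCorrelation μT t) (𝓝[>] 0) (𝓝 κ) := by
    intro T' hT' hlt
    obtain ⟨μT, D', κ, hGi, ht, hP, hAC, hκ, hlim⟩ := hcorner T' hT' hlt
    obtain ⟨hS, hSS⟩ :=
      OscillatorChain.isShiftInvariant_and_hasSuperstabilityEstimate_of_tight_pinnedChain γ hω hl.le hβ.le hT' hGi ht
    exact ⟨μT, D', κ, hGi, hS, hSS, hP, hAC, hκ, hlim⟩
  obtain ⟨μT, D, κ, hGi, hS, _hSS, _hcar, hP, hAC, hκ, hlim⟩ :=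
    continuation_of_regularSeeds hG ω₂ lam β γ hω hl hβ hγ T₀ hT₀ hreg T hT
  exact ⟨μT, D, κ, hGi, hS, hP, hAC, hκ, hlim⟩

end Summit.AtomisticToContinuum.FouriersLaw.Theorems.GreenKuboContinuation.TemperatureBlindVitaliHurwitz

end
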